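import Literature.NumberTheory.Automorphic.LevelControlInduced
import HarnessLib

/-!
# Exact finite-level control of the cohomology of the sections (degree one and top degree)

Topic `NumberTheory/Automorphic`; namespace `Literature.NumberTheory.Automorphic.LevelAction`;
theorems only (no new definitions, no named fact, no `sorry`).  Universe `0`.

Setting (`LevelActionInducedRegular`): levels `U ≤ U' ⊆ Δ`, `π : U' →* Q` with kernel `U`,
`Q` finite, a section `s` of `π`, coefficients `τ : Δ →* End V` with `V` flat over `R`, and an
element `α ∈ Δ` with an adapted family of representatives `α_j` (`IsAdaptedFamily`) whose cosets
enumerate `UαU/U`, resp. `U'αU'/U'`.  Transporting the induced-side statements of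
`LevelControlInduced` along Shapiro's isomorphisms `M(U, τ) ≅ 𝓕(R[Q])`, `M(U', τ) ≅ 𝓕(R)` and the
dictionary `res ↔ 𝓕(η)`, `tr ↔ 𝓕(ε)`, `⟨s t⟩ ↔ 𝓕(R_t)`, `[UαU] ↔ U^𝓕`, we obtain the control of
`H^*(U', τ) ⇄ H^*(U, τ)` in the form used by Hida (kernel and image of restriction into the
`Q`-invariants up to powers of `[UαU]`; surjectivity and kernel of the transfer in the top degree):

* **`pow_heckeCohomology_apply_eq_zero_of_resCohomology_eq_zero`** — `res x = 0 ⇒ [U'αU']^m x = 0`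
  as soon as `(U^𝓕)^m` kills `Hⁱ(𝓕 C)` (`i + 1 = j`);
* **`pow_heckeCohomology_apply_mem_range_resCohomology`** — `ξ ∈ Hʲ(U, τ)` fixed by all diamonds
  `[U (s t) U]` `⇒ [UαU]^n ξ ∈ range res`, as soon as `(U^𝓕)^n` kills `Hⁱ(𝓕 C'')`;
* **`trCohomology_surjective`** — `tr : Hʲ(U, τ) → Hʲ(U', τ)` is onto if `Hʲ⁺¹(𝓕 I_Q) = 0`;
* **`exists_eq_sum_of_trCohomology_eq_zero`** — `ker tr = ∑_t (⟨s t⟩ − 1) Hʲ(U, τ)` if moreover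
  `Hʲ⁺¹(𝓕 K) = 0`.

[cite: KhareThorne2017, §6.3, Prop. 6.6 and Lemma 6.9] [cite: Hida1994AIF, §2 (3.5), Thm 3.2].

## References

* C. Khare, J. A. Thorne, Amer. J. Math. 139 (2017), §6.3. [KhareThorne2017]
* H. Hida, Ann. Inst. Fourier 44 (1994), §2–§3. [Hida1994AIF]
-/

noncomputable section

open CategoryTheory groupCohomology

namespace Literature.NumberTheory.Automorphic

namespace LevelAction

/-! ### Two pieces of `ModuleCat` plumbing -/

/-- From a commuting square `f ≫ g = f' ≫ g'` in `Rep R Γ` to cohomology, pointwise. [folklore] -/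
theorem map_hom_map_hom_eq {R : Type} [CommRing R] {Γ : Type} [Group Γ] {A B C D : Rep R Γ}
    {f : A ⟶ B} {g : B ⟶ D} {f' : A ⟶ C} {g' : C ⟶ D} (h : f ≫ g = f' ≫ g') (j : ℕ)
    (x : groupCohomology A j) :
    (map (MonoidHom.id Γ) g j).hom ((map (MonoidHom.id Γ) f j).hom x) =
      (map (MonoidHom.id Γ) g' j).hom ((map (MonoidHom.id Γ) f' j).hom x) := by
  rw [← LinearMap.comp_apply, ← ModuleCat.hom_comp, ← map_id_comp, h, map_id_comp, ModuleCat.hom_comp,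
    LinearMap.comp_apply]

/-- `e.hom (e.inv y) = y` for an isomorphism of modules. [folklore] -/
theorem iso_hom_inv_apply {R : Type} [CommRing R] {A B : ModuleCat R} (e : A ≅ B) (y : B) :
    e.hom.hom (e.inv.hom y) = y := by
  rw [← LinearMap.comp_apply, ← ModuleCat.hom_comp, e.inv_hom_id, ModuleCat.hom_id, LinearMap.id_apply]

variable {R : Type} [CommRing R] {Γ 𝒢 : Type} [Group Γ] [Group 𝒢] (ι : Γ →* 𝒢)
  {Δ : Submonoid 𝒢} {V : Type} [AddCommGroup V] [Module R V] [Module.Flat R V]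
  (τ : Δ →* Module.End R V)
  {U U' : Subgroup 𝒢} (hU : U.toSubmonoid ≤ Δ) (hU' : U'.toSubmonoid ≤ Δ) (hle : U ≤ U')
  {Q : Type} [Group Q] [Fintype Q] [DecidableEq Q] (π : U' →* Q)
  (hker : ∀ u : U', π u = 1 ↔ (u : 𝒢) ∈ U) (s : Q → U') (hs : ∀ q, π (s q) = q)
  {J : Type} [Fintype J] {a : J → 𝒢} {α : 𝒢}

/-! ### Degree one: kernel and image of restriction -/

include hU hker s hs in
/-- **Kernel of restriction is killed by `[U'αU']^m`** as soon as `(U^𝓕)^m` kills `Hⁱ(𝓕 C)`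
(`i + 1 = j`; `C = R[Q]/R`).  In the application `i = 0` and `U^𝓕` is nilpotent on every
`H⁰(𝓕 N)`, so `res` is injective on ordinary parts. [cite: KhareThorne2017, §6.3, Prop. 6.6]
[cite: Hida1994AIF, §3, Thm 3.2] -/
theorem pow_heckeCohomology_apply_eq_zero_of_resCohomology_eq_zero (hα : α ∈ Δ)
    (ha : IsAdaptedFamily Δ U' π a)
    (hbij' : Set.BijOn (fun j => ((a j : 𝒢) : 𝒢 ⧸ U')) Set.univ (ArithmeticQuotient.doubleCosetQuot U' α))
    {i j : ℕ} (hij : i + 1 = j) {m : ℕ}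
    (h₃ : ∀ y : groupCohomology (inducedRep ι τ hU' π (cokerUnitRep R Q)) i,
      (inducedHeckeCohomology ι τ hU' π ha i ^ m) y = 0)
    (x : cohomology ι Δ τ U' j) (hx : (resCohomology ι Δ τ hle j).hom x = 0) :
    (heckeCohomology ι Δ τ U' hU' hα j ^ m) x = 0 := by
  have hx' : (inducedMapCohomology ι τ hU' π _ _ (unitMap R Q) (unitMap_equivariant R Q) j).hom
      ((map (MonoidHom.id Γ) (trivRepIso ι τ hU' π).hom j).hom x) = 0 := by
    rw [← map_hom_map_hom_eq (resRepHom_comp_shapiroIso_hom ι τ hU hU' hle π hker s hs) j x]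
    change (map (MonoidHom.id Γ) (shapiroIso ι τ hU hU' hle π hker s hs).hom j).hom
      ((resCohomology ι Δ τ hle j).hom x) = 0
    rw [hx, map_zero]
  have hK := pow_inducedHeckeCohomology_apply_eq_zero_of_map_unit_eq_zero ι τ hU' π ha hij h₃ _ hx'
  have hcomm : ∀ y, inducedHeckeCohomology ι τ hU' π ha j
      ((map (MonoidHom.id Γ) (trivRepIso ι τ hU' π).hom j).hom y) =
        (map (MonoidHom.id Γ) (trivRepIso ι τ hU' π).hom j).hom (heckeCohomology ι Δ τ U' hU' hα j y) :=
    fun y => (map_hom_map_hom_eq (heckeRepHom_comp_trivRepIso_hom ι τ hU' π hα ha hbij') j y).symm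
  rw [LevelControl.pow_apply_comp_eq _ _ _ hcomm m x] at hK
  exact (map_eq_zero_iff _
    ((groupCohomology.functor R Γ j).mapIso (trivRepIso ι τ hU' π)).toLinearEquiv.injective).1 hK

include hker hs in
/-- **Invariant classes restrict up to `[UαU]^n`**: if `(U^𝓕)^n` kills `Hⁱ(𝓕 C'')` (`i + 1 = j`)
then for every `ξ ∈ Hʲ(U, τ)` fixed by all the diamond operators `[U (s t) U]` (`t ∈ Q`),
`[UαU]^n ξ = res y` for some `y ∈ Hʲ(U', τ)`.  In the application `i = 0`, so `res` maps the
ordinary part ONTO the `Q`-invariants of the ordinary part. [cite: KhareThorne2017, §6.3, Prop. 6.6]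
[cite: Hida1994AIF, §3, Thm 3.2] -/
theorem pow_heckeCohomology_apply_mem_range_resCohomology (hα : α ∈ Δ) (ha : IsAdaptedFamily Δ U' π a)
    (hbij : Set.BijOn (fun j => ((a j : 𝒢) : 𝒢 ⧸ U)) Set.univ (ArithmeticQuotient.doubleCosetQuot U α))
    {i j : ℕ} (hij : i + 1 = j) {n : ℕ}
    (hC : ∀ c : groupCohomology (inducedRep ι τ hU' π (cokerDiffRep R Q)) i,
      (inducedHeckeCohomology ι τ hU' π ha i ^ n) c = 0)
    (ξ : cohomology ι Δ τ U j) (hξ : ∀ t : Q, heckeCohomology ι Δ τ U hU (hU' (s t).2) j ξ = ξ) :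
    (heckeCohomology ι Δ τ U hU hα j ^ n) ξ ∈ LinearMap.range (resCohomology ι Δ τ hle j).hom := by
  have hξ' : ∀ t : Q, (inducedHomCohomology ι τ hU' π _ _ (inducedShift ι τ hU' π t) j).hom
      ((map (MonoidHom.id Γ) (shapiroIso ι τ hU hU' hle π hker s hs).hom j).hom ξ) =
        (map (MonoidHom.id Γ) (shapiroIso ι τ hU hU' hle π hker s hs).hom j).hom ξ := fun t => by
    rw [← map_hom_map_hom_eq (heckeRepHom_lift_comp_shapiroIso_hom ι τ hU hU' hle π hker s hs t) j ξ]
    change (map (MonoidHom.id Γ) (shapiroIso ι τ hU hU' hle π hker s hs).hom j).hom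
      (heckeCohomology ι Δ τ U hU (hU' (s t).2) j ξ) = _
    rw [hξ t]
  obtain ⟨y', hy'⟩ := pow_inducedHeckeCohomology_apply_mem_range_of_forall ι τ hU' π ha hij hC _ hξ'
  have hcomm : ∀ y, inducedHeckeCohomology ι τ hU' π ha j
      ((map (MonoidHom.id Γ) (shapiroIso ι τ hU hU' hle π hker s hs).hom j).hom y) =
        (map (MonoidHom.id Γ) (shapiroIso ι τ hU hU' hle π hker s hs).hom j).hom
          (heckeCohomology ι Δ τ U hU hα j y) :=
    fun y => (map_hom_map_hom_eq (heckeRepHom_comp_shapiroIso_hom ι τ hU hU' hle π hker s hs hα ha hbij) j y).symm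
  rw [LevelControl.pow_apply_comp_eq _ _ _ hcomm n ξ] at hy'
  refine ⟨(map (MonoidHom.id Γ) (trivRepIso ι τ hU' π).inv j).hom y',
    ((groupCohomology.functor R Γ j).mapIso (shapiroIso ι τ hU hU' hle π hker s hs)).toLinearEquiv.injective ?_⟩
  have h2 : (map (MonoidHom.id Γ) (trivRepIso ι τ hU' π).hom j).hom
      ((map (MonoidHom.id Γ) (trivRepIso ι τ hU' π).inv j).hom y') = y' :=
    iso_hom_inv_apply ((groupCohomology.functor R Γ j).mapIso (trivRepIso ι τ hU' π)) y'
  change (map (MonoidHom.id Γ) (shapiroIso ι τ hU hU' hle π hker s hs).hom j).hom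
      ((resCohomology ι Δ τ hle j).hom ((map (MonoidHom.id Γ) (trivRepIso ι τ hU' π).inv j).hom y')) =
    (map (MonoidHom.id Γ) (shapiroIso ι τ hU hU' hle π hker s hs).hom j).hom ((heckeCohomology ι Δ τ U hU hα j ^ n) ξ)
  rw [← hy']
  change (map (MonoidHom.id Γ) (shapiroIso ι τ hU hU' hle π hker s hs).hom j).hom
      ((map (MonoidHom.id Γ) (resRepHom ι Δ τ hle) j).hom
        ((map (MonoidHom.id Γ) (trivRepIso ι τ hU' π).inv j).hom y')) = _
  rw [map_hom_map_hom_eq (resRepHom_comp_shapiroIso_hom ι τ hU hU' hle π hker s hs) j, h2]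

/-! ### Top degree: the transfer -/

include hle hker s hs in
/-- **The transfer `tr : Hʲ(U, τ) → Hʲ(U', τ)` is surjective if `Hʲ⁺¹(𝓕 I_Q) = 0`** (so in the top
cohomological degree). [cite: KhareThorne2017, §6.3, Prop. 6.6] -/
theorem trCohomology_surjective (j : ℕ)
    [Subsingleton (groupCohomology (inducedRep ι τ hU' π (augKerRep R Q)) (j + 1))] :
    Function.Surjective (trCohomology ι Δ τ hU hU' j).hom := fun z => by
  obtain ⟨w', hw'⟩ := map_inducedMap_augMap_surjective ι τ hU' π j
    ((map (MonoidHom.id Γ) (trivRepIso ι τ hU' π).hom j).hom z)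
  refine ⟨(map (MonoidHom.id Γ) (shapiroIso ι τ hU hU' hle π hker s hs).inv j).hom w',
    ((groupCohomology.functor R Γ j).mapIso (trivRepIso ι τ hU' π)).toLinearEquiv.injective ?_⟩
  have h3 : (map (MonoidHom.id Γ) (shapiroIso ι τ hU hU' hle π hker s hs).hom j).hom
      ((map (MonoidHom.id Γ) (shapiroIso ι τ hU hU' hle π hker s hs).inv j).hom w') = w' :=
    iso_hom_inv_apply ((groupCohomology.functor R Γ j).mapIso (shapiroIso ι τ hU hU' hle π hker s hs)) w'
  change (map (MonoidHom.id Γ) (trivRepIso ι τ hU' π).hom j).hom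
      ((map (MonoidHom.id Γ) (trRepHom ι Δ τ hU hU') j).hom
        ((map (MonoidHom.id Γ) (shapiroIso ι τ hU hU' hle π hker s hs).inv j).hom w')) =
    (map (MonoidHom.id Γ) (trivRepIso ι τ hU' π).hom j).hom z
  rw [← map_hom_map_hom_eq (shapiroIso_hom_comp_inducedMap_augMap ι τ hU hU' hle π hker s hs) j, h3, hw']

include hle hker hs in
/-- **The kernel of the transfer is `∑_t (⟨s t⟩ − 1) Hʲ(U, τ)` if `Hʲ⁺¹(𝓕 I_Q) = 0` and
`Hʲ⁺¹(𝓕 K) = 0`**: `tr` induces an isomorphism from the `Q`-coinvariants of `Hʲ(U, τ)` onto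
`Hʲ(U', τ)` in the top degree. [cite: KhareThorne2017, §6.3, Prop. 6.6] -/
theorem exists_eq_sum_of_trCohomology_eq_zero (j : ℕ)
    [Subsingleton (groupCohomology (inducedRep ι τ hU' π (sumDiffKerRep R Q)) (j + 1))]
    (x : cohomology ι Δ τ U j) (hx : (trCohomology ι Δ τ hU hU' j).hom x = 0) :
    ∃ b : Q → cohomology ι Δ τ U j,
      x = ∑ t : Q, (heckeCohomology ι Δ τ U hU (hU' (s t).2) j (b t) - b t) := by
  have hx' : (inducedMapCohomology ι τ hU' π _ _ (augMap R Q) (augMap_equivariant R Q) j).hom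
      ((map (MonoidHom.id Γ) (shapiroIso ι τ hU hU' hle π hker s hs).hom j).hom x) = 0 := by
    rw [map_hom_map_hom_eq (shapiroIso_hom_comp_inducedMap_augMap ι τ hU hU' hle π hker s hs) j x]
    change (map (MonoidHom.id Γ) (trivRepIso ι τ hU' π).hom j).hom ((trCohomology ι Δ τ hU hU' j).hom x) = 0
    rw [hx, map_zero]
  obtain ⟨b', hb'⟩ := exists_eq_sum_of_map_augMap_eq_zero ι τ hU' π j _ hx'
  refine ⟨fun t => (map (MonoidHom.id Γ) (shapiroIso ι τ hU hU' hle π hker s hs).inv j).hom (b' t),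
    ((groupCohomology.functor R Γ j).mapIso (shapiroIso ι τ hU hU' hle π hker s hs)).toLinearEquiv.injective ?_⟩
  change (map (MonoidHom.id Γ) (shapiroIso ι τ hU hU' hle π hker s hs).hom j).hom x =
    (map (MonoidHom.id Γ) (shapiroIso ι τ hU hU' hle π hker s hs).hom j).hom
      (∑ t : Q, (heckeCohomology ι Δ τ U hU (hU' (s t).2) j
        ((map (MonoidHom.id Γ) (shapiroIso ι τ hU hU' hle π hker s hs).inv j).hom (b' t)) -
          (map (MonoidHom.id Γ) (shapiroIso ι τ hU hU' hle π hker s hs).inv j).hom (b' t)))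
  rw [hb', map_sum]
  refine Finset.sum_congr rfl fun t _ => ?_
  have h3 : (map (MonoidHom.id Γ) (shapiroIso ι τ hU hU' hle π hker s hs).hom j).hom
      ((map (MonoidHom.id Γ) (shapiroIso ι τ hU hU' hle π hker s hs).inv j).hom (b' t)) = b' t :=
    iso_hom_inv_apply ((groupCohomology.functor R Γ j).mapIso (shapiroIso ι τ hU hU' hle π hker s hs)) (b' t)
  rw [map_sub, inducedHomCohomology, map_id_sub, groupCohomology.map_id, ModuleCat.hom_sub,
    LinearMap.sub_apply, ModuleCat.hom_id, LinearMap.id_apply]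
  change _ = (map (MonoidHom.id Γ) (shapiroIso ι τ hU hU' hle π hker s hs).hom j).hom
      ((map (MonoidHom.id Γ) (heckeRepHom ι Δ τ U hU (hU' (s t).2)) j).hom
        ((map (MonoidHom.id Γ) (shapiroIso ι τ hU hU' hle π hker s hs).inv j).hom (b' t))) - _
  rw [map_hom_map_hom_eq (heckeRepHom_lift_comp_shapiroIso_hom ι τ hU hU' hle π hker s hs t) j, h3]

end LevelAction

end Literature.NumberTheory.Automorphic
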